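import Summits.QuantumFields.YangMills.Theorems.UnitScaleTiltProp7TorusScaleCutoff
import Summits.QuantumFields.YangMills.Theorems.BalabanUVNodesN20LCSHullSeparation
import Summits.QuantumFields.YangMills.Theorems.BalabanUVNodesK0Stub1TouchedCentresOfDomains
import Summits.QuantumFields.Balaban3D.Proofs.Run3Collar
import Literature.MathematicalPhysics.QuantumFieldTheory.Balaban1983to89.B3Taylor310LocalRemainder
import Literature.MathematicalPhysics.QuantumFieldTheory.Balaban1983to89.B5Eq117TorusCarriers
import HarnessLib

/-!
# Route `UnitScaleTilt`, crux K1 «MinimiserStabilityRegPr» (stmt-QuantumFields-19200), route-R E′ path (α′), residue (hK), assembly (A), brick (Gm):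
# LATTICE GEOMETRY OF THE INSTANTIATION — `tdist` is 1-Lipschitz under lattice steps, a scale cutoff is LOCALLY CONSTANT off its annulus (whose site count is
# `≤ (2(⌈R⌉+1))^d`), the k-centres are `L^k`-SEPARATED in `tdist`, and the scale-`ℓ_β` cutoff bumps at the centres form a family with PAIRWISE DISJOINT supports

Cell `ym3-torus`, width seat `ym3-torus-px22` (gen 2) = the (A)-instantiation seat (★routeR-w3 g5 19:59:56Z); LOCATE 19200 evidence `LOCATE-A3-FARFIELD-px22g2.md` v1.2 §2, §5
rows (cnt)∕(Gm).  `--supports stmt-QuantumFields-19200`, count-neutral.  THEOREMS ONLY (0 `def`, 0 `sorry`).  YM₃ on T³ is a ladder rung (R3), not the Clay problem; nothing here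
claims the stub, the crux, d = 4 or the gap.

WHAT IS PROVED (ns `…Theorems.Prop7PinnedKernelGeometry`; torus `T^{(j)}` of the record, `tdist` = `Setup.Site.tdist`).
* §1 `tdist_shift_le_add_one`, `tdist_le_tdist_shift_add_one`, `tdist_unshift_le_add_one`, `tdist_le_tdist_unshift_add_one` (✓ `tdist_triangle` + ✓ `tdist_shift_le`).
* §2 ★ `locally_const_of_cutoff` — if `χ = 1` on `tdist(·,b) ≤ R₁` and `χ = 0` on `tdist(·,b) ≥ R₂` then `χ(z ± e_μ) = χ(z)` whenever `tdist(z,b) ≤ R₁ − 1` or `≥ R₂ + 1`;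
  ★ `locally_const_off_annulus` (the `Finset` form: off `T = {R₁ − 1 < tdist < R₂ + 1}`), `card_filter_tdist_lt_le` (`|{tdist(·,b) < R + 1}| ≤ (2(⌈R⌉₊+1))^d`, any real `R`, ✓ `card_torusBall_le`),
  `card_annulus_le`.
* §3 ★★ `pow_le_tdist_embIter_of_ne` — CENTRE SEPARATION: `y ≠ y′ → L^k ≤ tdist(embIter k y, embIter k y′)` (✓ `val_embIter_eq_pow_mul_add`: the centre labels are `L^k·(label) + off`,
  so a nonzero coordinate difference is `≡ L^k·t (mod L^k·M)` with `M ∤ t`, and its least residue is a NONZERO multiple of `L^k`); injectivity is ✓ `K0Stub1TouchedCentresOfDomains.embIter_injective`.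
* §4 ★★ `exists_bump_family` — for `1 ≤ ℓ_β` with `2(5√d·ℓ_β + 1) ≤ L^k`: bumps `β_y` (✓p660942 `exists_scale_cutoff` at base `embIter k y`, scale `ℓ_β`) with `β_y(e_y) = 1`, `β_y(e_{y′}) = 0`,
  `|Δ_cβ_y| ≤ 9dc²∕ℓ_β²`, `Δ_cβ_y = 0` off `S_y := {tdist(·,e_y) < 5√dℓ_β + 1}`, the `S_y` pairwise disjoint; ★ `exists_delta_family` — the same package with `β_y = δ_{e_y}`,
  `S_y = {tdist(·,e_y) ≤ 1}`, `|Δ_cδ| ≤ 4dc²`, disjoint as soon as `3 ≤ L^k` (small-ℓ branch).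
HONEST SCOPE.  Geometry only; consumed by the final (A) file together with ✓ `Prop7PinnedKernelSources`∕`Bumps`∕`L1OfRows`.

References: T. Bałaban, CMP 95 (1984) 17–40 [Balaban1984PropagatorsI] ((1.17)–(1.18) p.20); CMP 99 (1985) 75–102 [Balaban1985RegularSpaces] ((1.14) p.78).
-/

set_option autoImplicit false

noncomputable section

open scoped BigOperators

namespace Summit.QuantumFields.YangMills.Theorems.Prop7PinnedKernelGeometry

open Literature.MathematicalPhysics.QuantumFieldTheory.Balaban1983to89
open Finset LatticeFieldCalculus
open B15DeterminingSets (embIter)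
open B3Taylor310LocalRemainder (tdist_comm tdist_self tdist_triangle tdist_eq_sum_natAbs)
open Summit.QuantumFields.Balaban3D.Proofs.Run3Collar (tdist_shift_le)
open Summit.QuantumFields.Balaban3D.Proofs.TorusBalls (card_torusBall_le)
open B10StarCount (shift_unshift unshift_shift)
open Summit.QuantumFields.YangMills.BalabanUVNodes.N20LCSHullSeparation (val_embIter_eq_pow_mul_add)
open Summit.QuantumFields.YangMills.Theorems.K0Stub1TouchedCentresOfDomains (embIter_injective)
open Summit.QuantumFields.YangMills.Theorems.Prop7TorusAgmonWeight (exists_scale_cutoff)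

variable {P : Params} {j : ℕ}

/-! ## §1 `tdist` is 1-Lipschitz under lattice steps -/

/-- `tdist(x + e_μ, b) ≤ tdist(x, b) + 1`. [cite: Balaban1984PropagatorsI, (1.17) p.20] -/
theorem tdist_shift_le_add_one (x b : Site P j) (μ : Fin P.d) : Site.tdist (x.shift μ) b ≤ Site.tdist x b + 1 := by
  calc Site.tdist (x.shift μ) b ≤ Site.tdist (x.shift μ) x + Site.tdist x b := tdist_triangle _ _ _
    _ ≤ 1 + Site.tdist x b := by rw [tdist_comm (x.shift μ) x]; exact Nat.add_le_add_right (tdist_shift_le x μ) _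
    _ = Site.tdist x b + 1 := by ring

/-- `tdist(x, b) ≤ tdist(x + e_μ, b) + 1`. [cite: Balaban1984PropagatorsI, (1.17) p.20] -/
theorem tdist_le_tdist_shift_add_one (x b : Site P j) (μ : Fin P.d) : Site.tdist x b ≤ Site.tdist (x.shift μ) b + 1 := by
  calc Site.tdist x b ≤ Site.tdist x (x.shift μ) + Site.tdist (x.shift μ) b := tdist_triangle _ _ _
    _ ≤ 1 + Site.tdist (x.shift μ) b := Nat.add_le_add_right (tdist_shift_le x μ) _
    _ = Site.tdist (x.shift μ) b + 1 := by ring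

/-- `tdist(x − e_μ, b) ≤ tdist(x, b) + 1`. [cite: Balaban1984PropagatorsI, (1.17) p.20] -/
theorem tdist_unshift_le_add_one (x b : Site P j) (μ : Fin P.d) : Site.tdist (x.unshift μ) b ≤ Site.tdist x b + 1 := by
  have h := tdist_le_tdist_shift_add_one (x.unshift μ) b μ
  rwa [shift_unshift] at h

/-- `tdist(x, b) ≤ tdist(x − e_μ, b) + 1`. [cite: Balaban1984PropagatorsI, (1.17) p.20] -/
theorem tdist_le_tdist_unshift_add_one (x b : Site P j) (μ : Fin P.d) : Site.tdist x b ≤ Site.tdist (x.unshift μ) b + 1 := by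
  have h := tdist_shift_le_add_one (x.unshift μ) b μ
  rwa [shift_unshift] at h

/-! ## §2 A scale cutoff is locally constant off its annulus; the annulus has `≍ R₂^d` sites -/

/-- ★ **LOCAL CONSTANCY OFF THE ANNULUS**: if `χ = 1` on `{tdist(·,b) ≤ R₁}` and `χ = 0` on `{tdist(·,b) ≥ R₂}`, then at every `z` with `tdist(z,b) ≤ R₁ − 1` or `tdist(z,b) ≥ R₂ + 1`
the cutoff agrees with its values at all `2d` neighbours. [cite: Balaban1985RegularSpaces, (1.14) p.78] -/
theorem locally_const_of_cutoff (χ : SiteField P j ℝ) (b : Site P j) {R₁ R₂ : ℝ}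
    (hin : ∀ z, (Site.tdist z b : ℝ) ≤ R₁ → χ z = 1) (hout : ∀ z, R₂ ≤ (Site.tdist z b : ℝ) → χ z = 0)
    (z : Site P j) (hz : (Site.tdist z b : ℝ) ≤ R₁ - 1 ∨ R₂ + 1 ≤ (Site.tdist z b : ℝ)) (μ : Fin P.d) :
    χ (z.shift μ) = χ z ∧ χ (z.unshift μ) = χ z := by
  have h1 : (Site.tdist (z.shift μ) b : ℝ) ≤ Site.tdist z b + 1 := by exact_mod_cast tdist_shift_le_add_one z b μ
  have h2 : (Site.tdist z b : ℝ) ≤ Site.tdist (z.shift μ) b + 1 := by exact_mod_cast tdist_le_tdist_shift_add_one z b μ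
  have h3 : (Site.tdist (z.unshift μ) b : ℝ) ≤ Site.tdist z b + 1 := by exact_mod_cast tdist_unshift_le_add_one z b μ
  have h4 : (Site.tdist z b : ℝ) ≤ Site.tdist (z.unshift μ) b + 1 := by exact_mod_cast tdist_le_tdist_unshift_add_one z b μ
  rcases hz with hz | hz
  · rw [hin z (by linarith), hin _ (by linarith), hin _ (by linarith)]
    exact ⟨rfl, rfl⟩
  · rw [hout z (by linarith), hout _ (by linarith), hout _ (by linarith)]
    exact ⟨rfl, rfl⟩

/-- ★ **THE `Finset` FORM**: with `T := {z ∣ R₁ − 1 < tdist(z,b) ∧ tdist(z,b) < R₂ + 1}`, `χ` is locally constant at every `z ∉ T`. [cite: Balaban1985RegularSpaces, (1.14) p.78] -/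
theorem locally_const_off_annulus [DecidableEq (Site P j)] (χ : SiteField P j ℝ) (b : Site P j) {R₁ R₂ : ℝ}
    (hin : ∀ z, (Site.tdist z b : ℝ) ≤ R₁ → χ z = 1) (hout : ∀ z, R₂ ≤ (Site.tdist z b : ℝ) → χ z = 0) :
    ∀ z ∉ (Finset.univ.filter fun z : Site P j => R₁ - 1 < (Site.tdist z b : ℝ) ∧ (Site.tdist z b : ℝ) < R₂ + 1),
      ∀ μ, χ (z.shift μ) = χ z ∧ χ (z.unshift μ) = χ z := by
  intro z hz μ
  rw [Finset.mem_filter, not_and] at hz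
  have hz' := hz (Finset.mem_univ z)
  rw [not_and_or, not_lt, not_lt] at hz'
  exact locally_const_of_cutoff χ b hin hout z hz' μ

/-- **SITE COUNT**: `|{z ∣ tdist(z,b) < R + 1}| ≤ (2(⌈R⌉₊ + 1))^d`. [folklore] -/
theorem card_filter_tdist_lt_le [DecidableEq (Site P j)] (b : Site P j) (R : ℝ) :
    (Finset.univ.filter fun z : Site P j => (Site.tdist z b : ℝ) < R + 1).card ≤ (2 * (⌈R⌉₊ + 1)) ^ P.d := by
  classical
  refine le_trans (Finset.card_le_card ?_) (card_torusBall_le b ⌈R⌉₊)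
  intro z hz
  rw [Finset.mem_filter] at hz ⊢
  refine ⟨Finset.mem_univ _, ?_⟩
  rw [tdist_comm]
  have h1 : (Site.tdist z b : ℝ) < ⌈R⌉₊ + 1 := lt_of_lt_of_le hz.2 (by linarith [Nat.le_ceil R])
  have h2 : (Site.tdist z b : ℝ) < ((⌈R⌉₊ + 1 : ℕ) : ℝ) := by push_cast; exact h1
  have h3 : Site.tdist z b < ⌈R⌉₊ + 1 := by exact_mod_cast h2
  omega

/-- **THE ANNULUS COUNT**: `|T| ≤ (2(⌈R₂⌉₊ + 1))^d` for `T = {R₁ − 1 < tdist < R₂ + 1}`. [folklore] -/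
theorem card_annulus_le [DecidableEq (Site P j)] (b : Site P j) (R₁ R₂ : ℝ) :
    (Finset.univ.filter fun z : Site P j => R₁ - 1 < (Site.tdist z b : ℝ) ∧ (Site.tdist z b : ℝ) < R₂ + 1).card ≤ (2 * (⌈R₂⌉₊ + 1)) ^ P.d := by
  refine le_trans (Finset.card_le_card fun z hz => ?_) (card_filter_tdist_lt_le b R₂)
  rw [Finset.mem_filter] at hz ⊢
  exact ⟨hz.1, hz.2.2⟩

/-! ## §3 ★★ The k-centres are `L^k`-separated -/

/-- ★★ **CENTRE SEPARATION**: distinct k-centres are at `tdist ≥ L^k` on `T^{(0)}` (`k ≤ m + K`). [cite: Balaban1984PropagatorsI, (1.18) p.20] -/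
theorem pow_le_tdist_embIter_of_ne {k : ℕ} (hk : k ≤ P.m + P.K) {y y' : Site P k} (hne : y ≠ y') :
    P.L ^ k ≤ Site.tdist (embIter k y) (embIter k y') := by
  classical
  obtain ⟨ν, hν⟩ : ∃ ν, y ν ≠ y' ν := by
    by_contra h
    push Not at h
    exact hne (funext h)
  obtain ⟨off, hoff⟩ := val_embIter_eq_pow_mul_add (P := P) hk
  -- the periods: `N = L^k·M`
  set ℓ : ℕ := P.L ^ k with hℓ
  set M : ℕ := P.sitesPerDir k with hM
  set N : ℕ := P.sitesPerDir 0 with hN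
  have hNM : N = ℓ * M := B5Eq117TorusCarriers.sitesPerDir_zero_eq hk
  have hℓ0 : 0 < ℓ := pow_pos P.L_pos k
  -- the labels
  set p : ℕ := (y ν).val with hp
  set q : ℕ := (y' ν).val with hq
  have hpM : p < M := ZMod.val_lt _
  have hqM : q < M := ZMod.val_lt _
  have hpq : p ≠ q := fun h => hν (ZMod.val_injective _ h)
  -- the coordinate difference in `ZMod N` is `ℓ·(p − q)`
  set a : ZMod N := embIter k y ν - embIter k y' ν with ha
  have haval : a = (((ℓ : ℤ) * ((p : ℤ) - (q : ℤ)) : ℤ) : ZMod N) := by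
    have e1 : (embIter k y ν : ZMod N) = ((ℓ * p + off : ℕ) : ZMod N) := by
      rw [← ZMod.natCast_zmod_val (embIter k y ν), hoff y ν]
    have e2 : (embIter k y' ν : ZMod N) = ((ℓ * q + off : ℕ) : ZMod N) := by
      rw [← ZMod.natCast_zmod_val (embIter k y' ν), hoff y' ν]
    rw [ha, e1, e2]
    push_cast
    ring
  -- its least residue `v` is congruent to `ℓ(p − q)` mod `N = ℓM`
  set v : ℤ := a.valMinAbs with hv
  have hcong : ((v - (ℓ : ℤ) * ((p : ℤ) - (q : ℤ)) : ℤ) : ZMod N) = 0 := by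
    push_cast
    rw [hv, ZMod.coe_valMinAbs, haval]
    push_cast
    ring
  obtain ⟨m, hm⟩ := (ZMod.intCast_zmod_eq_zero_iff_dvd _ N).mp hcong
  -- so `v = ℓ·(p − q + M·m)` with a NONZERO second factor
  have hvℓ : v = (ℓ : ℤ) * ((p : ℤ) - (q : ℤ) + (M : ℤ) * m) := by
    have : (N : ℤ) = (ℓ : ℤ) * (M : ℤ) := by rw [hNM]; push_cast; ring
    rw [this] at hm
    linarith [hm]
  have hne0 : (p : ℤ) - (q : ℤ) + (M : ℤ) * m ≠ 0 := by
    intro h0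
    have hdvd : (M : ℤ) ∣ (p : ℤ) - (q : ℤ) := ⟨-m, by linarith⟩
    rcases le_or_gt m 0 with hm0 | hm0
    · rcases lt_or_eq_of_le hm0 with hm0 | hm0
      · have hm1 : m ≤ -1 := by omega
        have : (M : ℤ) * m ≤ -(M : ℤ) := by nlinarith
        have : (p : ℤ) - q ≥ M := by linarith
        linarith [show (p : ℤ) < M from by exact_mod_cast hpM, show (0 : ℤ) ≤ q from by positivity]
      · rw [hm0, mul_zero, add_zero, sub_eq_zero] at h0
        exact hpq (by exact_mod_cast h0)
    · have hm1 : 1 ≤ m := by omega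
      have : (M : ℤ) * m ≥ (M : ℤ) := by nlinarith
      have : (q : ℤ) - p ≥ M := by linarith
      linarith [show (q : ℤ) < M from by exact_mod_cast hqM, show (0 : ℤ) ≤ p from by positivity]
  have habs : (ℓ : ℤ) ≤ |v| := by
    rw [hvℓ, abs_mul, Nat.abs_cast]
    have h1 : (1 : ℤ) ≤ |(p : ℤ) - (q : ℤ) + (M : ℤ) * m| := Int.one_le_abs hne0
    nlinarith
  -- `tdist ≥` the `ν`-coordinate residue
  rw [tdist_eq_sum_natAbs]
  have hterm : ℓ ≤ ((embIter k y ν - embIter k y' ν).valMinAbs).natAbs := by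
    have : ((ℓ : ℕ) : ℤ) ≤ (((embIter k y ν - embIter k y' ν).valMinAbs).natAbs : ℤ) := by
      rw [Int.natCast_natAbs]; exact habs
    exact_mod_cast this
  exact hterm.trans (Finset.single_le_sum (f := fun μ => ((embIter k y μ - embIter k y' μ).valMinAbs).natAbs)
    (fun μ _ => Nat.zero_le _) (Finset.mem_univ ν))

/-! ## §4 ★★ Bump families with pairwise disjoint supports -/

/-- ★★ **THE SMOOTH BUMP FAMILY** (large-ℓ branch): for `1 ≤ ℓ_β` with `2(5√d·ℓ_β + 1) ≤ L^k`, at every k-centre a C¹ cutoff bump of scale `ℓ_β` (✓ `exists_scale_cutoff`):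
`β_y(e_y) = 1`, `β_y(e_{y′}) = 0` (`y′ ≠ y`), `|Δ_cβ_y| ≤ 9dc²∕ℓ_β²` for every `c`, `Δ_cβ_y = 0` off `S_y = {tdist(·,e_y) < 5√dℓ_β + 1}`, and the `S_y` are pairwise disjoint
(centre separation). [cite: Balaban1985RegularSpaces, (1.14) p.78] -/
theorem exists_bump_family [DecidableEq (Site P 0)] {k : ℕ} (hk : k ≤ P.m + P.K) {ℓβ : ℝ} (hℓβ : 1 ≤ ℓβ)
    (hsep : 2 * (5 * Real.sqrt P.d * ℓβ + 1) ≤ (P.L : ℝ) ^ k) :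
    ∃ β : Site P k → SiteField P 0 ℝ,
      (∀ y, β y (embIter k y) = 1)
      ∧ (∀ y y', y ≠ y' → β y (embIter k y') = 0)
      ∧ (∀ (c : ℝ) y z, |laplace c (β y) z| ≤ 9 * P.d * c ^ 2 / ℓβ ^ 2)
      ∧ (∀ (c : ℝ) y z, z ∉ (Finset.univ.filter fun z : Site P 0 => (Site.tdist z (embIter k y) : ℝ) < 5 * Real.sqrt P.d * ℓβ + 1) →
          laplace c (β y) z = 0)
      ∧ ∀ y y', y ≠ y' → Disjoint
          (Finset.univ.filter fun z : Site P 0 => (Site.tdist z (embIter k y) : ℝ) < 5 * Real.sqrt P.d * ℓβ + 1)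
          (Finset.univ.filter fun z : Site P 0 => (Site.tdist z (embIter k y') : ℝ) < 5 * Real.sqrt P.d * ℓβ + 1) := by
  have hsd : 0 ≤ Real.sqrt P.d := Real.sqrt_nonneg _
  have hcut := fun y : Site P k => exists_scale_cutoff (P := P) (j := 0) (embIter k y) hℓβ
  choose β h01 hin hout hd1 hd2 hmix hlap using hcut
  refine ⟨β, fun y => ?_, fun y y' hyy' => ?_, fun c y z => hlap y c z, fun c y z hz => ?_, fun y y' hyy' => ?_⟩
  · exact hin y _ (by rw [tdist_self]; push_cast; linarith)
  · refine hout y _ ?_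
    have hsep' := pow_le_tdist_embIter_of_ne hk hyy'
    rw [tdist_comm] at hsep'
    have : ((P.L : ℝ) ^ k) ≤ (Site.tdist (embIter k y') (embIter k y) : ℝ) := by exact_mod_cast hsep'
    nlinarith
  · -- off `S_y`, `β_y` vanishes at `z` and its neighbours
    rw [Finset.mem_filter, not_and] at hz
    have hz' : 5 * Real.sqrt P.d * ℓβ + 1 ≤ (Site.tdist z (embIter k y) : ℝ) := not_lt.mp (hz (Finset.mem_univ z))
    have hloc := locally_const_of_cutoff (β y) (embIter k y) (R₁ := ℓβ) (hin y) (hout y) z (Or.inr hz')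
    have h0 : β y z = 0 := hout y z (by linarith)
    simp only [laplace, smul_eq_mul]
    refine Finset.sum_eq_zero fun μ _ => ?_
    rw [(hloc μ).1, (hloc μ).2, h0]; ring
  · rw [Finset.disjoint_filter]
    intro z _ hz hz'
    have hsep' : ((P.L : ℝ) ^ k) ≤ (Site.tdist (embIter k y) (embIter k y') : ℝ) := by exact_mod_cast pow_le_tdist_embIter_of_ne hk hyy'
    have htri : (Site.tdist (embIter k y) (embIter k y') : ℝ) ≤ Site.tdist (embIter k y) z + Site.tdist z (embIter k y') := by
      exact_mod_cast tdist_triangle _ _ _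
    rw [tdist_comm (embIter k y) z] at htri
    linarith

/-- ★ **THE DELTA FAMILY** (small-ℓ branch, `3 ≤ L^k`): `β_y = δ_{e_y}`, `S_y = {tdist(·,e_y) < 2}`, `|Δ_cδ| ≤ 4dc²`, pairwise disjoint supports. [cite: Balaban1985RegularSpaces, (1.14) p.78] -/
theorem exists_delta_family [DecidableEq (Site P 0)] {k : ℕ} (hk : k ≤ P.m + P.K) (h3 : 3 ≤ P.L ^ k) :
    ∃ β : Site P k → SiteField P 0 ℝ,
      (∀ y, β y (embIter k y) = 1)
      ∧ (∀ y y', y ≠ y' → β y (embIter k y') = 0)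
      ∧ (∀ (c : ℝ) y z, |laplace c (β y) z| ≤ 4 * P.d * c ^ 2)
      ∧ (∀ (c : ℝ) y z, z ∉ (Finset.univ.filter fun z : Site P 0 => (Site.tdist z (embIter k y) : ℝ) < (1 : ℝ) + 1) → laplace c (β y) z = 0)
      ∧ ∀ y y', y ≠ y' → Disjoint
          (Finset.univ.filter fun z : Site P 0 => (Site.tdist z (embIter k y) : ℝ) < (1 : ℝ) + 1)
          (Finset.univ.filter fun z : Site P 0 => (Site.tdist z (embIter k y') : ℝ) < (1 : ℝ) + 1) := by
  refine ⟨fun y z => if z = embIter k y then 1 else 0, fun y => by simp, fun y y' hyy' => ?_, fun c y z => ?_, fun c y z hz => ?_, fun y y' hyy' => ?_⟩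
  · have : embIter k y' ≠ embIter k y := fun h => hyy' ((embIter_injective hk) h).symm
    simp [this]
  · simp only [laplace, smul_eq_mul]
    calc |∑ μ : Fin P.d, c ^ 2 * ((if z = embIter k y then (1:ℝ) else 0) + (if z = embIter k y then (1:ℝ) else 0)
            - (if z.shift μ = embIter k y then (1:ℝ) else 0) - (if z.unshift μ = embIter k y then (1:ℝ) else 0))|
        ≤ ∑ μ : Fin P.d, |c ^ 2 * ((if z = embIter k y then (1:ℝ) else 0) + (if z = embIter k y then (1:ℝ) else 0)
            - (if z.shift μ = embIter k y then (1:ℝ) else 0) - (if z.unshift μ = embIter k y then (1:ℝ) else 0))| := Finset.abs_sum_le_sum_abs _ _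
      _ ≤ ∑ _μ : Fin P.d, 4 * c ^ 2 := Finset.sum_le_sum fun μ _ => by
          rw [abs_mul, abs_of_nonneg (sq_nonneg c), mul_comm]
          refine mul_le_mul_of_nonneg_right ?_ (sq_nonneg c)
          refine (abs_sub _ _).trans ((add_le_add (abs_sub _ _) le_rfl).trans ?_)
          refine (add_le_add (add_le_add (abs_add_le _ _) le_rfl) le_rfl).trans ?_
          have e : ∀ (q : Prop) [Decidable q], |(if q then (1:ℝ) else 0)| ≤ 1 := fun q _ => by split_ifs <;> simp
          linarith [e (z = embIter k y), e (z.shift μ = embIter k y), e (z.unshift μ = embIter k y)]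
      _ = 4 * P.d * c ^ 2 := by rw [Finset.sum_const, Finset.card_univ, Fintype.card_fin, nsmul_eq_mul]; ring
  · rw [Finset.mem_filter, not_and] at hz
    have hz' : (2 : ℝ) ≤ (Site.tdist z (embIter k y) : ℝ) := by linarith [not_lt.mp (hz (Finset.mem_univ z))]
    have hz2 : 2 ≤ Site.tdist z (embIter k y) := by exact_mod_cast hz'
    have h0 : z ≠ embIter k y := fun h => by rw [h, tdist_self] at hz2; omega
    have h1 : ∀ μ, z.shift μ ≠ embIter k y := fun μ h => by
      have := tdist_le_tdist_shift_add_one z (embIter k y) μ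
      rw [h, tdist_self] at this; omega
    have h2 : ∀ μ, z.unshift μ ≠ embIter k y := fun μ h => by
      have := tdist_le_tdist_unshift_add_one z (embIter k y) μ
      rw [h, tdist_self] at this; omega
    simp only [laplace, smul_eq_mul, if_neg h0, if_neg (h1 _), if_neg (h2 _)]
    simp
  · rw [Finset.disjoint_filter]
    intro z _ hz hz'
    have hz2 : (Site.tdist z (embIter k y) : ℝ) < 2 := by linarith
    have hz2' : (Site.tdist z (embIter k y') : ℝ) < 2 := by linarith
    have hn : Site.tdist z (embIter k y) < 2 := by exact_mod_cast hz2
    have hn' : Site.tdist z (embIter k y') < 2 := by exact_mod_cast hz2'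
    have hsep' := pow_le_tdist_embIter_of_ne hk hyy'
    have htri := tdist_triangle (embIter k y) z (embIter k y')
    rw [tdist_comm (embIter k y) z] at htri
    omega

end Summit.QuantumFields.YangMills.Theorems.Prop7PinnedKernelGeometry

end
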